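import Mathlib
import Summits.CriticalPhenomena.PercolationContinuityZ3.Theorems.PercNearOneGluingNoHeavyLowerTailOrientedAntipodalHall

/-!
# Relabelling petals: Theorem O on `k'` petals transfers to any number of petals

Helper file for crux `stmt-CriticalPhenomena-4575` (`NoHeavyLowerTail`, route `PercNearOneGluingNoHeavy`),
new-inequality factory seat `prim-ineq-gen-3` (gen 13).  Everything here is PROVED.

The census files `…OrientedAntipodalHallFiveCertA/B/C` state Theorem O (distinct good representatives for the
antipodal bads of an opposite-free type class) for labelings into `Lab 5`.  A class supported on five of `k` petals
reduces to that case: push the labeling `f : Finset α → Lab k` forward along ANY map of petals `π : Fin k → Fin k'`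
(`B ↦ B`, `A ↦ A`, `Cₚ ↦ C_{π p}`) — the result `f'` is again monotone (petals are pairwise incomparable), has the
SAME good sets, and a bad of type `(p, q)` becomes a bad of type `(π p, π q)` (when `π p ≠ π q`, which the target
theorem's type hypothesis enforces).  `exists_injective_good_above_of_relabel` packages this: an SDR statement for
the pushed-forward labeling gives the SDR statement for `f`.  (prim-ineq-gen-3 gen 13, 2026-08-21; memo
FINDINGS-gen13.md in `run/shared/lean/prim/prim-ineq-gen-3/`.)
-/

namespace Summit.CriticalPhenomena.PercolationContinuityZ3.Theorems

namespace OrientedAntipodalHall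

open Finset AntipodalStrongHarris AntipodalStrongHarris.Lab
open scoped FinsetFamily

variable {α : Type*} [DecidableEq α] {k k' : ℕ}

/-- **Relabelling petals.**  Let `π : Fin k → Fin k'` be any map of petals and `f` a monotone labeling into `Lab k`
with a family `D` of bads (`f X = C_{i X}`, `f (S \ X) = C_{j X}`).  If the SDR conclusion of Theorem O holds for EVERY
monotone labeling `f'` into `Lab k'` that has the same good sets as `f` (same sets labelled `A`, same sets labelled
`B`) and under which every `X ∈ D` is a bad of type `(π (i X), π (j X))`, then it holds for `f`.  (Apply it to the
push-forward of `f` along `π`.) -/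
theorem exists_injective_good_above_of_relabel (π : Fin k → Fin k') (S : Finset α) {f : Finset α → Lab k}
    (hf : ∀ ⦃X Y : Finset α⦄, X ⊆ Y → f X ≤ f Y) (D : Finset (Finset α)) (i j : Finset α → Fin k)
    (hDi : ∀ X ∈ D, f X = petal (i X)) (hDj : ∀ X ∈ D, f (S \ X) = petal (j X))
    (H : ∀ f' : Finset α → Lab k', (∀ ⦃X Y : Finset α⦄, X ⊆ Y → f' X ≤ f' Y) →
      (∀ X ∈ D, f' X = petal (π (i X))) → (∀ X ∈ D, f' (S \ X) = petal (π (j X))) →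
      (∀ U, f' U = top ↔ f U = top) → (∀ U, f' U = bot ↔ f U = bot) →
      ∃ φ : D → Finset α, Function.Injective φ ∧
        ∀ X : D, (X : Finset α) ⊆ φ X ∧ φ X ⊆ S ∧ f' (φ X) = top ∧ f' (S \ φ X) = bot) :
    ∃ φ : D → Finset α, Function.Injective φ ∧
      ∀ X : D, (X : Finset α) ⊆ φ X ∧ φ X ⊆ S ∧ f (φ X) = top ∧ f (S \ φ X) = bot := by
  -- the push-forward labeling
  let g : Lab k → Lab k' := fun c => match c with
    | bot => bot
    | petal p => petal (π p)
    | top => top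
  have hg_mono : ∀ c d : Lab k, c ≤ d → g c ≤ g d := by
    intro c d hcd
    rw [le_def] at hcd ⊢
    rcases hcd with h | h | h
    · left; rw [h]
    · right; left; rw [h]
    · right; right; rw [h]
  have hg_top : ∀ c : Lab k, g c = top ↔ c = top := by
    intro c; rcases c with _ | p | _ <;> simp [g]
  have hg_bot : ∀ c : Lab k, g c = bot ↔ c = bot := by
    intro c; rcases c with _ | p | _ <;> simp [g]
  let f' : Finset α → Lab k' := fun U => g (f U)
  have hf' : ∀ ⦃X Y : Finset α⦄, X ⊆ Y → f' X ≤ f' Y := fun X Y hXY => hg_mono _ _ (hf hXY)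
  have hDi' : ∀ X ∈ D, f' X = petal (π (i X)) := by
    intro X hX; show g (f X) = _; rw [hDi X hX]
  have hDj' : ∀ X ∈ D, f' (S \ X) = petal (π (j X)) := by
    intro X hX; show g (f (S \ X)) = _; rw [hDj X hX]
  obtain ⟨φ, hφinj, hφ⟩ := H f' hf' hDi' hDj' (fun U => hg_top (f U)) (fun U => hg_bot (f U))
  refine ⟨φ, hφinj, fun X => ?_⟩
  obtain ⟨h1, h2, h3, h4⟩ := hφ X
  exact ⟨h1, h2, (hg_top _).mp h3, (hg_bot _).mp h4⟩

end OrientedAntipodalHall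

end Summit.CriticalPhenomena.PercolationContinuityZ3.Theorems
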